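import Literature.Topology.FourManifolds.TubeFlowGeometry
import HarnessLib

/-!
# Flow-saturated functions: functions of the lifted level function, extended across the
# non-hitting set, and cut off in height

Topic `Literature/Topology/FourManifolds`; step E3a of a Morse-theoretic construction of
Gay–Kirby's trisection for the fact seat
`provefact-Literature.Topology.FourManifolds.exists_isBalancedGKTrisection` (Gay–Kirby 2016,
Thm. 4 via §4, Lemma 14).  Everything in this file is **proved**; the definitions are explicit
functions.

The faces and the Morse functions of the sectors of the trisection are built from functions of
the form `G(φ̄)`, where `φ̄ = flowLift φ` is the lift along trajectories of a Heegaard function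
`φ` on the level `Y = f⁻¹(a)` (`FlowFibreMorseData.lean`) and `G` is a one-variable profile which
is **constant (`= G₀`) below a threshold `v₀`**.  Such a function extends by `G₀` across the
points whose trajectory does not meet `Y` (`satLift`, smooth wherever, locally, the hitting
points have `φ̄ ≤ v₀` — `contMDiffAt_satLift_of_forall_le`), and a function smooth near a band
`f⁻¹[a + s₁, a + s₂]` is made global by a cut-off in the height (`heightCut`,
`contMDiff_heightCut`).  For the `2`-handle tubes of the trisection the local smallness of `φ̄`
near the non-hitting set (the unstable discs, `TubeFlowGeometry.lean`) is
`MilnorBox.exists_nhds_forall_hits_imp` below.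

## References

* J. Milnor, *Lectures on the h-cobordism theorem* (1965), proof of Thm. 3.12, Thm. 4.1,
  proof of Thm. 5.4 (Assertion 4). [MilnorHCobordism1965]
* D. Gay, R. Kirby, *Trisecting 4-manifolds*, Geom. Topol. 20 (2016), §4, Lemma 14. [GayKirby2016]
-/

open scoped Manifold ContDiff Topology
open Set Function Filter Metric

noncomputable section

universe u

namespace Literature.Topology.FourManifolds

open Flow

/-- Local notation: `𝔼 n` is the model Euclidean space `EuclideanSpace ℝ (Fin n)`. -/
local notation "𝔼 " n:arg => EuclideanSpace ℝ (Fin n)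

section HeightCutDefs

variable {M : Type u} {f : M → ℝ} {a : ℝ}

/-! ### Cutting off in the height -/

/-- **Height cut-off**: `χ(f z - a) · (Φ z - Φ₀) + Φ₀`. [folklore] -/
def heightCut (f : M → ℝ) (a : ℝ) (χ : ℝ → ℝ) (Φ : M → ℝ) (Φ₀ : ℝ) (z : M) : ℝ :=
  χ (f z - a) * (Φ z - Φ₀) + Φ₀

/-- Where `χ(f - a) = 1`, the cut-off function is `Φ`. [folklore] -/
theorem heightCut_of_eq_one {χ : ℝ → ℝ} {Φ : M → ℝ} {Φ₀ : ℝ} {z : M} (hz : χ (f z - a) = 1) :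
    heightCut f a χ Φ Φ₀ z = Φ z := by
  simp [heightCut, hz]

/-- Where `χ(f - a) = 0`, the cut-off function is `Φ₀`. [folklore] -/
theorem heightCut_of_eq_zero {χ : ℝ → ℝ} {Φ : M → ℝ} {Φ₀ : ℝ} {z : M} (hz : χ (f z - a) = 0) :
    heightCut f a χ Φ Φ₀ z = Φ₀ := by
  simp [heightCut, hz]

end HeightCutDefs

section General

variable {m : ℕ} {M : Type u} [TopologicalSpace M] [T2Space M] [CompactSpace M]
  [ChartedSpace (𝔼 (m + 1)) M] [IsManifold (𝓡 (m + 1)) ∞ M]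
  {f : M → ℝ} {ξ : Π x : M, TangentSpace (𝓡 (m + 1)) x} {a : ℝ}
  {hξ : ContMDiff (𝓡 (m + 1)) (𝓡 (m + 1)).tangent ∞ fun x => (⟨x, ξ x⟩ : TangentBundle (𝓡 (m + 1)) M)}
  {h : IsRegularLevel (𝓡 (m + 1)) f a}

/-! ### `G(φ̄)` extended by a constant across the non-hitting set -/

/-- **The saturated lift** of a profile `G` of the Heegaard function: `G(φ̄ z)` if the orbit of
`z` meets the level, the constant `G₀` otherwise. [cite: GayKirby2016, §4, Lemma 14] -/
def satLift (hξ : ContMDiff (𝓡 (m + 1)) (𝓡 (m + 1)).tangent ∞ fun x => (⟨x, ξ x⟩ : TangentBundle (𝓡 (m + 1)) M))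
    (h : IsRegularLevel (𝓡 (m + 1)) f a) (φ : RegularLevel h → ℝ) (G : ℝ → ℝ) (G₀ : ℝ) (z : M) : ℝ :=
  open scoped Classical in if Hits (flowθ hξ) f a z then G (flowLift hξ h φ z) else G₀

/-- On hitting points, `satLift = G ∘ φ̄`. [folklore] -/
theorem satLift_of_hits {φ : RegularLevel h → ℝ} {G : ℝ → ℝ} {G₀ : ℝ} {z : M}
    (hz : Hits (flowθ hξ) f a z) : satLift hξ h φ G G₀ z = G (flowLift hξ h φ z) := by
  classical
  exact if_pos hz

/-- Off the hitting set, `satLift = G₀`. [folklore] -/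
theorem satLift_of_not_hits {φ : RegularLevel h → ℝ} {G : ℝ → ℝ} {G₀ : ℝ} {z : M}
    (hz : ¬ Hits (flowθ hξ) f a z) : satLift hξ h φ G G₀ z = G₀ := by
  classical
  exact if_neg hz

/-- `satLift` is constant along trajectories. [folklore] -/
theorem satLift_flow (hgl : IsGradientLike (𝓡 (m + 1)) f ξ) (hfM : IsMorse (𝓡 (m + 1)) f)
    (φ : RegularLevel h → ℝ) (G : ℝ → ℝ) (G₀ : ℝ) (z : M) (t : ℝ) :
    satLift hξ h φ G G₀ (flow hξ z t) = satLift hξ h φ G G₀ z := by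
  by_cases hz : Hits (flowθ hξ) f a z
  · have hzt : Hits (flowθ hξ) f a (flow hξ z t) := (isSmoothFlow_flow hξ).hits_apply_iff.2 hz
    rw [satLift_of_hits hzt, satLift_of_hits hz, flowLift_flow hgl hfM φ hz t]
  · have hzt : ¬ Hits (flowθ hξ) f a (flow hξ z t) := fun h' => hz ((isSmoothFlow_flow hξ).hits_apply_iff.1 h')
    rw [satLift_of_not_hits hzt, satLift_of_not_hits hz]

/-- **`satLift` is smooth at hitting points** (`{Hits}` is open and `φ̄` is smooth there).
[cite: MilnorHCobordism1965, proof of Thm. 5.4, Assertion 4] -/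
theorem contMDiffAt_satLift_of_hits (hgl : IsGradientLike (𝓡 (m + 1)) f ξ) (hfM : IsMorse (𝓡 (m + 1)) f)
    {φ : RegularLevel h → ℝ} (hφ : ContMDiff (𝓡 m) 𝓘(ℝ, ℝ) ∞ φ) {G : ℝ → ℝ} (hG : ContDiff ℝ ∞ G)
    (G₀ : ℝ) {z : M} (hz : Hits (flowθ hξ) f a z) :
    ContMDiffAt (𝓡 (m + 1)) 𝓘(ℝ, ℝ) ∞ (satLift hξ h φ G G₀) z := by
  have hev : satLift hξ h φ G G₀ =ᶠ[𝓝 z] fun w => G (flowLift hξ h φ w) := by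
    filter_upwards [(hgl.isOpen_setOf_hits hfM hξ h.forall_not_isMCriticalPt).mem_nhds hz] with w hw
    exact satLift_of_hits hw
  refine ContMDiffAt.congr_of_eventuallyEq ?_ hev
  exact (hG.contMDiff.contMDiffAt).comp z (contMDiffAt_flowLift hgl hfM hφ hz)

/-- **`satLift` is smooth (indeed locally constant) at a point near which every hitting point
has `φ̄ ≤ v₀`**, if `G = G₀` on `(-∞, v₀]`. [cite: GayKirby2016, §4, Lemma 14] -/
theorem contMDiffAt_satLift_of_forall_le {φ : RegularLevel h → ℝ} {G : ℝ → ℝ} {G₀ v₀ : ℝ}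
    (hG : ∀ t ≤ v₀, G t = G₀) {z : M} {U : Set M} (hU : U ∈ 𝓝 z)
    (hle : ∀ w ∈ U, Hits (flowθ hξ) f a w → flowLift hξ h φ w ≤ v₀) :
    ContMDiffAt (𝓡 (m + 1)) 𝓘(ℝ, ℝ) ∞ (satLift hξ h φ G G₀) z := by
  have hev : satLift hξ h φ G G₀ =ᶠ[𝓝 z] fun _ => G₀ := by
    filter_upwards [hU] with w hw
    by_cases hh : Hits (flowθ hξ) f a w
    · rw [satLift_of_hits hh, hG _ (hle w hw hh)]
    · exact satLift_of_not_hits hh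
  exact contMDiffAt_const.congr_of_eventuallyEq hev

/-- The value of `satLift` at such a point is `G₀`. [folklore] -/
theorem satLift_eq_of_forall_le {φ : RegularLevel h → ℝ} {G : ℝ → ℝ} {G₀ v₀ : ℝ}
    (hG : ∀ t ≤ v₀, G t = G₀) {z : M}
    (hle : Hits (flowθ hξ) f a z → flowLift hξ h φ z ≤ v₀) : satLift hξ h φ G G₀ z = G₀ := by
  by_cases hh : Hits (flowθ hξ) f a z
  · rw [satLift_of_hits hh, hG _ (hle hh)]
  · exact satLift_of_not_hits hh

/-! ### Smoothness of the height cut-off -/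

omit [T2Space M] [CompactSpace M] [IsManifold (𝓡 (m + 1)) ∞ M] in
/-- **The height cut-off is smooth** if `χ` is smooth, `f` is smooth, and `Φ` is smooth at every
point `z` with `f z - a ∈ tsupport χ` (elsewhere `χ(f - a)` vanishes near `z`). [folklore] -/
theorem contMDiff_heightCut {χ : ℝ → ℝ} (hχ : ContDiff ℝ ∞ χ) (hf : ContMDiff (𝓡 (m + 1)) 𝓘(ℝ, ℝ) ∞ f)
    {Φ : M → ℝ} (Φ₀ : ℝ) (hΦ : ∀ z, f z - a ∈ tsupport χ → ContMDiffAt (𝓡 (m + 1)) 𝓘(ℝ, ℝ) ∞ Φ z) :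
    ContMDiff (𝓡 (m + 1)) 𝓘(ℝ, ℝ) ∞ (heightCut f a χ Φ Φ₀) := by
  intro z
  have hχf : ContMDiffAt (𝓡 (m + 1)) 𝓘(ℝ, ℝ) ∞ (fun w => χ (f w - a)) z :=
    (hχ.contMDiff.contMDiffAt).comp z ((hf z).sub contMDiffAt_const)
  by_cases hz : f z - a ∈ tsupport χ
  · exact (hχf.mul ((hΦ z hz).sub contMDiffAt_const)).add contMDiffAt_const
  · -- `χ (f - a) = 0` near `z`
    have hopen : IsOpen ((fun w => f w - a) ⁻¹' (tsupport χ)ᶜ) :=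
      (isClosed_tsupport χ).isOpen_compl.preimage (hf.continuous.sub continuous_const)
    have hev : heightCut f a χ Φ Φ₀ =ᶠ[𝓝 z] fun _ => Φ₀ := by
      filter_upwards [hopen.mem_nhds hz] with w hw
      exact heightCut_of_eq_zero (image_eq_zero_of_notMem_tsupport hw)
    exact contMDiffAt_const.congr_of_eventuallyEq hev

end General

/-! ### Local smallness of `φ̄` near the unstable discs of the `2`-handles -/

section Tubes

variable {M : Type u} [TopologicalSpace M] [T2Space M] [CompactSpace M]
  [ChartedSpace (𝔼 4) M] [IsManifold (𝓡 4) ∞ M]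
  {f : M → ℝ} {ξ : Π x : M, TangentSpace (𝓡 4) x} {c : M}
  {hξ : ContMDiff (𝓡 4) (𝓡 4).tangent ∞ fun x => (⟨x, ξ x⟩ : TangentBundle (𝓡 4) M)}

/-- **Near the unstable disc, hitting points project into the thin tube.**  Let `D` be an
index-`2` box of `(f, ξ)` about `c`, `0 < δ₁ ≤ η`, `η + (B₁ + δ₁) < ε²`, the level `f c - η`
regular.  A point `z₀` of the box with `A(z₀) = 0` and `f z₀ < f c + B₁` has a
neighbourhood on which every point `w` hitting the level `f c - η` has `A(w) > 0`, projects to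
`π w = flow w t` in the closed box with `A(π w) = η + B(π w)` and
`A(π w) · B(π w) = A(w) · B(w) < δ₁ (B₁ + δ₁)`, and the tube function agrees:
`𝒯(coord π w) = 𝒯(coord w)`.  (So any function of `π w` controlled by `P = A·B` is small there.)
[cite: MilnorHCobordism1965, proof of Thm. 3.12; Thm. 4.1] [cite: GayKirby2016, §4, Lemma 14] -/
theorem MilnorBox.exists_nhds_forall_hits_imp (D : MilnorBox (𝓡 4) f ξ c) (hk : D.k = 2)
    (hgl : IsGradientLike (𝓡 4) f ξ) (hfM : IsMorse (𝓡 4) f) {η B₁ δ₁ : ℝ} (hη : 0 < η) (hδ₁ : 0 < δ₁)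
    (hδη : δ₁ ≤ η) (hsmall : η + (B₁ + δ₁) < D.ε ^ 2)
    (hreg : ∀ x, f x = f c - η → ¬ IsMCriticalPt (𝓡 4) f x)
    {z₀ : M} (hz₀ : z₀ ∈ D.box) (hA₀ : sqSumLT D.k (D.coord z₀) = 0) (hf₀ : f z₀ < f c + B₁) :
    ∃ U ∈ 𝓝 z₀, ∀ w ∈ U, Hits (flowθ hξ) f (f c - η) w →
      w ∈ D.chart.source ∧ 0 < sqSumLT D.k (D.coord w) ∧ sqSumLT D.k (D.coord w) < δ₁ ∧
      ∃ t ≤ 0, levelProj hξ f (f c - η) w = flow hξ w t ∧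
        flow hξ w t ∈ D.chart.source ∧
        sqSumLT D.k (D.coord (flow hξ w t)) = η + sqSumGE D.k (D.coord (flow hξ w t)) ∧
        sqSumLT D.k (D.coord (flow hξ w t)) * sqSumGE D.k (D.coord (flow hξ w t)) < δ₁ * (B₁ + δ₁) ∧
        ∀ ε' κ η' : ℝ, TubeModel.tube ε' κ η' (D.coord (flow hξ w t)) = TubeModel.tube ε' κ η' (D.coord w) := by
  have hcontA : ContinuousOn (fun q' => sqSumLT D.k (D.coord q')) D.chart.source := D.continuousOn_sqSum_coord.1
  set U : Set M := D.box ∩ (D.chart.source ∩ (fun q' => sqSumLT D.k (D.coord q')) ⁻¹' Iio δ₁) ∩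
    {w | f w < f c + B₁} with hU
  have hUo : IsOpen U :=
    (D.isOpen_box.inter (hcontA.isOpen_inter_preimage D.chart.open_source isOpen_Iio)).inter
      (isOpen_lt hfM.contMDiff.continuous continuous_const)
  have hz₀U : z₀ ∈ U := ⟨⟨hz₀, hz₀.1, by simp only [mem_preimage, mem_Iio, hA₀]; exact hδ₁⟩, hf₀⟩
  refine ⟨U, hUo.mem_nhds hz₀U, fun w hw hhit => ?_⟩
  obtain ⟨⟨hwbox, hwsrc, hwA⟩, hwf⟩ := hw
  have hwA' : sqSumLT D.k (D.coord w) < δ₁ := hwA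
  have hwf' : f w < f c + B₁ := hwf
  have hApos : 0 < sqSumLT D.k (D.coord w) := by
    rcases (sqSumLT_nonneg D.k (D.coord w)).eq_or_lt with h0 | h0
    · exact absurd hhit (D.not_hits_of_sqSumLT_eq_zero hgl hfM hη hwbox h0.symm)
    · exact h0
  have hfw : f w = f c - sqSumLT D.k (D.coord w) + sqSumGE D.k (D.coord w) := D.apply_eq_sub_add hwsrc
  have hBw : sqSumGE D.k (D.coord w) ≤ B₁ + δ₁ := by linarith [hwf', hwA', hfw]
  have hfz : f c - η ≤ f w := by linarith [hwA', hδη, sqSumGE_nonneg D.k (D.coord w), hfw]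
  obtain ⟨t, ht, -, hproj, hseg, hP, htube, hlevel⟩ :=
    D.exists_levelProj_eq_flow (hξ := hξ) hk hgl hfM hη hsmall hreg hwsrc hApos hfz hBw
  refine ⟨hwsrc, hApos, hwA', t, ht, hproj, (hseg t ⟨le_rfl, ht⟩).1, hlevel, ?_, htube⟩
  rw [hP]
  have hBnn : 0 ≤ sqSumGE D.k (D.coord w) := sqSumGE_nonneg _ _
  calc sqSumLT D.k (D.coord w) * sqSumGE D.k (D.coord w)
      ≤ sqSumLT D.k (D.coord w) * (B₁ + δ₁) := mul_le_mul_of_nonneg_left hBw hApos.le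
    _ < δ₁ * (B₁ + δ₁) := mul_lt_mul_of_pos_right hwA' (by linarith)

end Tubes

end Literature.Topology.FourManifolds

end
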